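import Mathlib
import Summits.Ventures.PercRepro2.CoinChainReductionGen
import Summits.Ventures.PercRepro2.CoinChainHeadHyps
import Summits.Ventures.PercRepro2.CoinChainBernstein

/-!
# The PURE chain at every coin probability when the world-0 law is centred right, and row
2′DARC at the chain from the coin-free Bernstein inequalities
(blind cell PercRepro2, night-2 g22; proofs/NIGHT2-DARC.md §62)

* `pureChain_functional_nonneg_of_world0Centred` — the pure chain (`ent = ∅`) holds at EVERY
  `ρ ∈ [0, 1]` for every pair of nonnegative increasing markers as soon as the world-0 law
  `ν·c` centred at the world-1 `R`-means has nonnegative cleared functional (`hT10`: the single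
  unproved mixed-centre term `U(1,1,0)` of the Bernstein form); the other seven terms are kernel
  facts (`chain_functional_nonneg_of_bernstein`, `U(1,0,0) = U(0,1,0) = Λ¹·D₀` by FKG of `ν·c`).
  In the notation of §58, `hT10` reads `Cov₀ + (p₁ − p₀)(q₁ − q₀) ≥ 0`: it holds under the
  same-sign hypothesis of `pureChain_functional_nonneg_of_sameSign` and also for anti-aligned
  world shifts whenever the world-0 covariance pays their product.
* `darc_of_chain_of_bernstein` — row 2′DARC at the general AND-switch chain under the two
  coin-free inequalities `hU110`, `hU100` on the chain data (`chain_darc_of_functional`).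
* `darc_of_pureChain_of_world0Centred` — row 2′DARC at the pure chain under `hT10` alone.
-/

namespace Summit.Ventures.PercRepro2.Coin

open Classical

section PureBernstein

variable {V : Type*} [DecidableEq V] {R : Type*} [Field R] [LinearOrder R] [IsStrictOrderedRing R]

/-- **THE PURE CHAIN AT EVERY COIN PROBABILITY WHEN THE WORLD-0 LAW IS CENTRED RIGHT.** -/
theorem pureChain_functional_nonneg_of_world0Centred (U ent' : Finset V) (ν c d d' : Finset V → R)
    (ρ : R) (hρ0 : 0 ≤ ρ) (hρ1 : ρ ≤ 1) (hν0 : ∀ W, 0 ≤ ν W)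
    (hν : ∀ s ⊆ U, ∀ t ⊆ U, ν s * ν t ≤ ν (s ∩ t) * ν (s ∪ t))
    (hc0 : ∀ W, 0 ≤ c W) (hd0 : ∀ W, 0 ≤ d W) (hd'0 : ∀ W, 0 ≤ d' W)
    (hdc : ∀ W, d W ≤ c W) (hd'c : ∀ W, d' W ≤ c W)
    (hcc : ∀ s t, c s * c t ≤ c (s ∩ t) * c (s ∪ t))
    (hdd : ∀ s t, d s * d t ≤ d (s ∩ t) * d (s ∪ t))
    (hd'd' : ∀ s t, d' s * d' t ≤ d' (s ∩ t) * d' (s ∪ t))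
    (hcd : ∀ s t, c s * d t ≤ c (s ∩ t) * d (s ∪ t))
    (hcd' : ∀ s t, c s * d' t ≤ c (s ∩ t) * d' (s ∪ t))
    (hdd' : ∀ s t, d s * d' t ≤ d (s ∩ t) * d' (s ∪ t))
    (hratio : ∀ s t, s ⊆ t → d s * c t ≤ c s * d t)
    (hratio' : ∀ s t, s ⊆ t → d' s * c t ≤ c s * d' t)
    (x y : Finset V → R) (hx0 : ∀ W, 0 ≤ x W) (hy0 : ∀ W, 0 ≤ y W)
    (hxm : ∀ s t, x s ≤ x (s ∪ t)) (hym : ∀ s t, y s ≤ y (s ∪ t))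
    (hT10 : 0 ≤ (∑ W ∈ U.powerset, ν W * chainMix ∅ ent' 1 c d W) *
          (∑ W ∈ U.powerset, ν W * chainMix ∅ ent' 1 c d W) *
          (∑ W ∈ U.powerset, ν W * c W * (x W * y W))
        - (∑ W ∈ U.powerset, ν W * chainMix ∅ ent' 1 c d W) *
          (∑ W ∈ U.powerset, ν W * chainMix ∅ ent' 1 c d W * y W) *
          (∑ W ∈ U.powerset, ν W * c W * x W)
        - (∑ W ∈ U.powerset, ν W * chainMix ∅ ent' 1 c d W) *
          (∑ W ∈ U.powerset, ν W * chainMix ∅ ent' 1 c d W * x W) *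
          (∑ W ∈ U.powerset, ν W * c W * y W)
        + (∑ W ∈ U.powerset, ν W * chainMix ∅ ent' 1 c d W * x W) *
          (∑ W ∈ U.powerset, ν W * chainMix ∅ ent' 1 c d W * y W) *
          (∑ W ∈ U.powerset, ν W * c W)) :
    0 ≤ (∑ W ∈ U.powerset, ν W * chainMix ∅ ent' ρ c d W) ^ 2 *
          (∑ W ∈ U.powerset, ν W * chainMix ∅ ent' ρ c d' W * (x W * y W))
        - (∑ W ∈ U.powerset, ν W * chainMix ∅ ent' ρ c d W) *
          (∑ W ∈ U.powerset, ν W * chainMix ∅ ent' ρ c d W * x W) *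
          (∑ W ∈ U.powerset, ν W * chainMix ∅ ent' ρ c d' W * y W)
        - (∑ W ∈ U.powerset, ν W * chainMix ∅ ent' ρ c d W) *
          (∑ W ∈ U.powerset, ν W * chainMix ∅ ent' ρ c d W * y W) *
          (∑ W ∈ U.powerset, ν W * chainMix ∅ ent' ρ c d' W * x W)
        + (∑ W ∈ U.powerset, ν W * chainMix ∅ ent' ρ c d W * x W) *
          (∑ W ∈ U.powerset, ν W * chainMix ∅ ent' ρ c d W * y W) *
          (∑ W ∈ U.powerset, ν W * chainMix ∅ ent' ρ c d' W) := by
  -- FKG of the world-0 law `ν·c` with general increasing markers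
  have hL₀0 : ∀ W, 0 ≤ ν W * c W := fun W => mul_nonneg (hν0 W) (hc0 W)
  have hD : (∑ W ∈ U.powerset, ν W * c W * x W) * (∑ W ∈ U.powerset, ν W * c W * y W) ≤
      (∑ W ∈ U.powerset, ν W * c W) * (∑ W ∈ U.powerset, ν W * c W * (x W * y W)) := by
    refine ad_pointwise U (fun W => ν W * c W * x W) (fun W => ν W * c W * y W)
      (fun W => ν W * c W) (fun W => ν W * c W * (x W * y W))
      (fun W => mul_nonneg (hL₀0 W) (hx0 W)) (fun W => mul_nonneg (hL₀0 W) (hy0 W)) hL₀0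
      (fun W => mul_nonneg (hL₀0 W) (mul_nonneg (hx0 W) (hy0 W))) ?_
    intro s hs t ht
    have e1 : ν s * ν t ≤ ν (s ∩ t) * ν (s ∪ t) := hν s hs t ht
    have e2 := hcc s t
    have e3 := hxm s t
    have e4 : y t ≤ y (s ∪ t) := by rw [Finset.union_comm]; exact hym t s
    calc ν s * c s * x s * (ν t * c t * y t)
        = (ν s * ν t) * (c s * c t) * (x s * y t) := by ring
      _ ≤ (ν (s ∩ t) * ν (s ∪ t)) * (c (s ∩ t) * c (s ∪ t)) * (x (s ∪ t) * y (s ∪ t)) := by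
          apply mul_le_mul (mul_le_mul e1 e2 (mul_nonneg (hc0 _) (hc0 _))
            (mul_nonneg (hν0 _) (hν0 _)))
            (mul_le_mul e3 e4 (hy0 _) (hx0 _)) (mul_nonneg (hx0 _) (hy0 _))
            (mul_nonneg (mul_nonneg (hν0 _) (hν0 _)) (mul_nonneg (hc0 _) (hc0 _)))
      _ = ν (s ∩ t) * c (s ∩ t) * (ν (s ∪ t) * c (s ∪ t) * (x (s ∪ t) * y (s ∪ t))) := by ring
  have hb0 : 0 ≤ ∑ W ∈ U.powerset, ν W * chainMix ∅ ent' 1 c d W :=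
    Finset.sum_nonneg fun W _ =>
      mul_nonneg (hν0 W) (chainMix_nonneg ∅ ent' zero_le_one le_rfl hc0 hd0 W)
  refine chain_functional_nonneg_of_bernstein U ∅ ent' ν c d d' ρ hρ0 hρ1 hν0 hν hc0 hd0 hd'0 hdc
    hd'c hcc hdd hd'd' hcd hcd' hdd' hratio hratio' x y hx0 hy0 hxm hym ?_ ?_
  · simp only [chainMix_zero_empty]
    exact hT10
  · simp only [chainMix_zero_empty]
    nlinarith [mul_nonneg hb0 (sub_nonneg.mpr hD)]

end PureBernstein

section BernsteinDarc

variable {V : Type*} {E : Type*} [Fintype V] [DecidableEq V] [Fintype E] [DecidableEq E]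
  {R : Type*} [Field R] [LinearOrder R] [IsStrictOrderedRing R]
  {arcs : E → Finset (V × V)} {s : V} {U : Finset V} {ent ent' : Finset V} {c' : V → E}
  {a' a w : V} {c : V → E}

/-- **ROW 2′DARC AT THE GENERAL AND-SWITCH CHAIN FROM THE TWO COIN-FREE BERNSTEIN INEQUALITIES**
on the chain data (`R⁰ = P(level)·chainMix 0 chainC chainD`, `R¹ = … 1 …`, `G⁰ = … 0 … chainD'`,
point markers `m₁, m₂`): `hU110` — `G⁰` centred at the `R¹`-means — and `hU100` — the two
mixed-centre functionals of `G⁰` summed. -/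
theorem darc_of_chain_of_bernstein (pr : E → R) (hp : IsProbVec pr) (hS : SameEnds arcs)
    (h' : OrTailK arcs s U ent' c' a') (hsure' : ∀ r ∈ ent', pr (c' r) = 1)
    (h : OrTailK arcs s (insert a' U) (insert a' ent) c a) (hsure : ∀ r ∈ ent, pr (c r) = 1)
    (hentU : ent ⊆ U)
    {m₁ m₂ : V} (hm₁ : m₁ ∈ U) (hm₂ : m₂ ∈ U)
    (hν : ∀ W W', W ⊆ U → W' ⊆ U →
      prob pr (coreLevel arcs s U W) * prob pr (coreLevel arcs s U W') ≤
        prob pr (coreLevel arcs s U (W ∩ W')) * prob pr (coreLevel arcs s U (W ∪ W')))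
    {t : V} (htC : t ∉ insert a (insert a' U)) (hts : t ≠ s) (hws : w ≠ s)
    (hwC : w ∉ insert a (insert a' U))
    (hU110 : 0 ≤ (∑ W ∈ U.powerset, prob pr (coreLevel arcs s U W) *
            chainMix ent ent' 1 (chainC pr arcs s t U ent' a' a) (chainD pr arcs s t U ent' a' a) W) *
          (∑ W ∈ U.powerset, prob pr (coreLevel arcs s U W) *
            chainMix ent ent' 1 (chainC pr arcs s t U ent' a' a) (chainD pr arcs s t U ent' a' a) W) *
          (∑ W ∈ U.powerset, prob pr (coreLevel arcs s U W) *
            chainMix ent ent' 0 (chainC pr arcs s t U ent' a' a) (chainD' pr arcs s t U ent' a' a w) W *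
            ((if m₁ ∈ W then (1 : R) else 0) * (if m₂ ∈ W then (1 : R) else 0)))
        - (∑ W ∈ U.powerset, prob pr (coreLevel arcs s U W) *
            chainMix ent ent' 1 (chainC pr arcs s t U ent' a' a) (chainD pr arcs s t U ent' a' a) W) *
          (∑ W ∈ U.powerset, prob pr (coreLevel arcs s U W) *
            chainMix ent ent' 1 (chainC pr arcs s t U ent' a' a) (chainD pr arcs s t U ent' a' a) W *
            (if m₂ ∈ W then (1 : R) else 0)) *
          (∑ W ∈ U.powerset, prob pr (coreLevel arcs s U W) *
            chainMix ent ent' 0 (chainC pr arcs s t U ent' a' a) (chainD' pr arcs s t U ent' a' a w) W *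
            (if m₁ ∈ W then (1 : R) else 0))
        - (∑ W ∈ U.powerset, prob pr (coreLevel arcs s U W) *
            chainMix ent ent' 1 (chainC pr arcs s t U ent' a' a) (chainD pr arcs s t U ent' a' a) W) *
          (∑ W ∈ U.powerset, prob pr (coreLevel arcs s U W) *
            chainMix ent ent' 1 (chainC pr arcs s t U ent' a' a) (chainD pr arcs s t U ent' a' a) W *
            (if m₁ ∈ W then (1 : R) else 0)) *
          (∑ W ∈ U.powerset, prob pr (coreLevel arcs s U W) *
            chainMix ent ent' 0 (chainC pr arcs s t U ent' a' a) (chainD' pr arcs s t U ent' a' a w) W *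
            (if m₂ ∈ W then (1 : R) else 0))
        + (∑ W ∈ U.powerset, prob pr (coreLevel arcs s U W) *
            chainMix ent ent' 1 (chainC pr arcs s t U ent' a' a) (chainD pr arcs s t U ent' a' a) W *
            (if m₁ ∈ W then (1 : R) else 0)) *
          (∑ W ∈ U.powerset, prob pr (coreLevel arcs s U W) *
            chainMix ent ent' 1 (chainC pr arcs s t U ent' a' a) (chainD pr arcs s t U ent' a' a) W *
            (if m₂ ∈ W then (1 : R) else 0)) *
          (∑ W ∈ U.powerset, prob pr (coreLevel arcs s U W) *
            chainMix ent ent' 0 (chainC pr arcs s t U ent' a' a) (chainD' pr arcs s t U ent' a' a w) W))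
    (hU100 : 0 ≤ ((∑ W ∈ U.powerset, prob pr (coreLevel arcs s U W) *
            chainMix ent ent' 1 (chainC pr arcs s t U ent' a' a) (chainD pr arcs s t U ent' a' a) W) *
          (∑ W ∈ U.powerset, prob pr (coreLevel arcs s U W) *
            chainMix ent ent' 0 (chainC pr arcs s t U ent' a' a) (chainD pr arcs s t U ent' a' a) W) *
          (∑ W ∈ U.powerset, prob pr (coreLevel arcs s U W) *
            chainMix ent ent' 0 (chainC pr arcs s t U ent' a' a) (chainD' pr arcs s t U ent' a' a w) W *
            ((if m₁ ∈ W then (1 : R) else 0) * (if m₂ ∈ W then (1 : R) else 0)))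
        - (∑ W ∈ U.powerset, prob pr (coreLevel arcs s U W) *
            chainMix ent ent' 1 (chainC pr arcs s t U ent' a' a) (chainD pr arcs s t U ent' a' a) W) *
          (∑ W ∈ U.powerset, prob pr (coreLevel arcs s U W) *
            chainMix ent ent' 0 (chainC pr arcs s t U ent' a' a) (chainD pr arcs s t U ent' a' a) W *
            (if m₂ ∈ W then (1 : R) else 0)) *
          (∑ W ∈ U.powerset, prob pr (coreLevel arcs s U W) *
            chainMix ent ent' 0 (chainC pr arcs s t U ent' a' a) (chainD' pr arcs s t U ent' a' a w) W *
            (if m₁ ∈ W then (1 : R) else 0))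
        - (∑ W ∈ U.powerset, prob pr (coreLevel arcs s U W) *
            chainMix ent ent' 0 (chainC pr arcs s t U ent' a' a) (chainD pr arcs s t U ent' a' a) W) *
          (∑ W ∈ U.powerset, prob pr (coreLevel arcs s U W) *
            chainMix ent ent' 1 (chainC pr arcs s t U ent' a' a) (chainD pr arcs s t U ent' a' a) W *
            (if m₁ ∈ W then (1 : R) else 0)) *
          (∑ W ∈ U.powerset, prob pr (coreLevel arcs s U W) *
            chainMix ent ent' 0 (chainC pr arcs s t U ent' a' a) (chainD' pr arcs s t U ent' a' a w) W *
            (if m₂ ∈ W then (1 : R) else 0))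
        + (∑ W ∈ U.powerset, prob pr (coreLevel arcs s U W) *
            chainMix ent ent' 1 (chainC pr arcs s t U ent' a' a) (chainD pr arcs s t U ent' a' a) W *
            (if m₁ ∈ W then (1 : R) else 0)) *
          (∑ W ∈ U.powerset, prob pr (coreLevel arcs s U W) *
            chainMix ent ent' 0 (chainC pr arcs s t U ent' a' a) (chainD pr arcs s t U ent' a' a) W *
            (if m₂ ∈ W then (1 : R) else 0)) *
          (∑ W ∈ U.powerset, prob pr (coreLevel arcs s U W) *
            chainMix ent ent' 0 (chainC pr arcs s t U ent' a' a) (chainD' pr arcs s t U ent' a' a w) W))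
        + ((∑ W ∈ U.powerset, prob pr (coreLevel arcs s U W) *
            chainMix ent ent' 0 (chainC pr arcs s t U ent' a' a) (chainD pr arcs s t U ent' a' a) W) *
          (∑ W ∈ U.powerset, prob pr (coreLevel arcs s U W) *
            chainMix ent ent' 1 (chainC pr arcs s t U ent' a' a) (chainD pr arcs s t U ent' a' a) W) *
          (∑ W ∈ U.powerset, prob pr (coreLevel arcs s U W) *
            chainMix ent ent' 0 (chainC pr arcs s t U ent' a' a) (chainD' pr arcs s t U ent' a' a w) W *
            ((if m₁ ∈ W then (1 : R) else 0) * (if m₂ ∈ W then (1 : R) else 0)))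
        - (∑ W ∈ U.powerset, prob pr (coreLevel arcs s U W) *
            chainMix ent ent' 0 (chainC pr arcs s t U ent' a' a) (chainD pr arcs s t U ent' a' a) W) *
          (∑ W ∈ U.powerset, prob pr (coreLevel arcs s U W) *
            chainMix ent ent' 1 (chainC pr arcs s t U ent' a' a) (chainD pr arcs s t U ent' a' a) W *
            (if m₂ ∈ W then (1 : R) else 0)) *
          (∑ W ∈ U.powerset, prob pr (coreLevel arcs s U W) *
            chainMix ent ent' 0 (chainC pr arcs s t U ent' a' a) (chainD' pr arcs s t U ent' a' a w) W *
            (if m₁ ∈ W then (1 : R) else 0))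
        - (∑ W ∈ U.powerset, prob pr (coreLevel arcs s U W) *
            chainMix ent ent' 1 (chainC pr arcs s t U ent' a' a) (chainD pr arcs s t U ent' a' a) W) *
          (∑ W ∈ U.powerset, prob pr (coreLevel arcs s U W) *
            chainMix ent ent' 0 (chainC pr arcs s t U ent' a' a) (chainD pr arcs s t U ent' a' a) W *
            (if m₁ ∈ W then (1 : R) else 0)) *
          (∑ W ∈ U.powerset, prob pr (coreLevel arcs s U W) *
            chainMix ent ent' 0 (chainC pr arcs s t U ent' a' a) (chainD' pr arcs s t U ent' a' a w) W *
            (if m₂ ∈ W then (1 : R) else 0))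
        + (∑ W ∈ U.powerset, prob pr (coreLevel arcs s U W) *
            chainMix ent ent' 0 (chainC pr arcs s t U ent' a' a) (chainD pr arcs s t U ent' a' a) W *
            (if m₁ ∈ W then (1 : R) else 0)) *
          (∑ W ∈ U.powerset, prob pr (coreLevel arcs s U W) *
            chainMix ent ent' 1 (chainC pr arcs s t U ent' a' a) (chainD pr arcs s t U ent' a' a) W *
            (if m₂ ∈ W then (1 : R) else 0)) *
          (∑ W ∈ U.powerset, prob pr (coreLevel arcs s U W) *
            chainMix ent ent' 0 (chainC pr arcs s t U ent' a' a) (chainD' pr arcs s t U ent' a' a w) W))) :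
    DARC pr arcs s {t} m₁ m₂ a w := by
  obtain ⟨hA0, hAmono, hAlsm⟩ := OrTailU.head_props (U := insert a' U) (a := a) pr hp hS t
  obtain ⟨hdc, hd'd, hcc, hdd, hd'd', hdd', hratio, hratio', -, hcd, hcd'⟩ :=
    chainPhi_head_hyps (fun X => prob pr (coreAvoidEvent arcs s t (insert a (insert a' U)) X))
      ent' a' a w hA0 hAmono hAlsm
  have hx0 : ∀ W : Finset V, (0 : R) ≤ (if m₁ ∈ W then (1 : R) else 0) := by
    intro W; split_ifs <;> norm_num
  have hy0 : ∀ W : Finset V, (0 : R) ≤ (if m₂ ∈ W then (1 : R) else 0) := by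
    intro W; split_ifs <;> norm_num
  have hxm : ∀ s t : Finset V,
      (if m₁ ∈ s then (1 : R) else 0) ≤ (if m₁ ∈ s ∪ t then (1 : R) else 0) := by
    intro s t
    by_cases h : m₁ ∈ s
    · rw [if_pos h, if_pos (Finset.mem_union_left t h)]
    · rw [if_neg h]; split_ifs <;> norm_num
  have hym : ∀ s t : Finset V,
      (if m₂ ∈ s then (1 : R) else 0) ≤ (if m₂ ∈ s ∪ t then (1 : R) else 0) := by
    intro s t
    by_cases h : m₂ ∈ s
    · rw [if_pos h, if_pos (Finset.mem_union_left t h)]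
    · rw [if_neg h]; split_ifs <;> norm_num
  refine chain_darc_of_functional pr hS h' hsure' h hsure hentU hm₁ hm₂ htC hts hws hwC ?_
  exact chain_functional_nonneg_of_bernstein U ent ent' (fun W => prob pr (coreLevel arcs s U W))
    (chainC pr arcs s t U ent' a' a) (chainD pr arcs s t U ent' a' a) (chainD' pr arcs s t U ent' a' a w)
    (pr (c a')) (hp.nonneg _) (hp.le_one _) (fun W => prob_nonneg hp _)
    (fun s' hs' t' ht' => hν s' t' hs' ht') (fun W => hA0 _) (fun W => hA0 _) (fun W => hA0 _)
    hdc (fun W => le_trans (hd'd W) (hdc W)) hcc hdd hd'd' hcd hcd' hdd' hratio hratio'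
    (fun W => if m₁ ∈ W then (1 : R) else 0) (fun W => if m₂ ∈ W then (1 : R) else 0)
    hx0 hy0 hxm hym hU110 hU100

end BernsteinDarc

end Summit.Ventures.PercRepro2.Coin
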